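import Literature.NumberTheory.GaloisCohomology.FrobeniusDeRham
import Literature.NumberTheory.GaloisCohomology.DerivationTower
import Literature.NumberTheory.GaloisCohomology.AddPowDerivation
import Literature.NumberTheory.GaloisCohomology.KatoCokerInverseCartier
import HarnessLib

/-!
# The inverse Cartier operator `γ : Ωⁿ_K → Hⁿ_dR(K) = Zⁿ/Bⁿ` of a ring of characteristic `p`,
# and Kato's `H^{n+1}_p(K) = coker(γ − 1)`

For a commutative ring `K` of prime characteristic `p`, the **inverse Cartier operator** in degree `n` is the
unique `p`-semilinear map `γ : Ωⁿ_K = ⋀ⁿ_K Ω[K⁄ℤ] → Zⁿ/Bⁿ` (closed modulo exact `n`-forms) with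

`γ (a · db₁ ∧ ⋯ ∧ dbₙ) = [a^p · b₁^{p-1} ⋯ bₙ^{p-1} · db₁ ∧ ⋯ ∧ dbₙ]`, i.e. `γ (a · dlog b) = [a^p · dlog b]`

([cite: GilleSzamuely2017, Lemma 9.2.1 (degree 1) and §9.4 (multiplicative extension)]; Cartier 1957,
Katz 1970 (7.2), Illusie 1979 0.(2.1)).  This file CONSTRUCTS it (`invCartier p K n`, a `K`-linear map into the
Frobenius-twisted de Rham cohomology `deRhamH p K n` of `FrobeniusDeRham.lean` — `K`-linearity into the twist
is `p`-semilinearity) by the derivation-tower engine `DerivationTower` applied to the derivation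
`b ↦ (b^{p-1} db) ∧ –` (`cartierDerivation`): additivity is `(a+b)^{p-1}d(a+b) − a^{p-1}da − b^{p-1}db = dS_p(a,b)`
(`AddPowDerivation`) together with `ds ∧ ω = d(sω)` on closed `ω`; the Leibniz rule is
`(ab)^{p-1}d(ab) = a^p b^{p-1}db + b^p a^{p-1}da`; alternation comes from `θ ∧ θ = 0` and anticommutativity.

Main results:
* `invCartier_ιMulti_D` : `γ (db₁ ∧ ⋯ ∧ dbₙ) = [b₁^{p-1}db₁ ∧ ⋯ ∧ bₙ^{p-1}dbₙ]`;
* `invCartier_smul_dlogForm` : `γ (a • dlog b₁ ∧ ⋯ ∧ dlog bₙ) = [a^p • dlog b₁ ∧ ⋯ ∧ dlog bₙ]` (units `bᵢ`);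
* `invCartierQuot` : the composite additive map `Ωⁿ_K → Ωⁿ_K/Bⁿ_K` and
  `mem_exactForms_sup_artinSchreierForms_iff` : for a field `K` whose logarithmic forms span `Ωⁿ_K` (true for
  every field: `stub_formsSpan` of summit ResolutionOfSingularities, taken here as the hypothesis `hspan`),
  **`ω ∈ Bⁿ_K + ⟨(a^p − a) dlog b⟩ ↔ [ω] ∈ im(γ − 1)`** — so the tree's `KatoCohomologyDeRham p K n`
  (`KatoCohomologyDifferentialForms`) IS the printed `H^{n+1}_p(K) = coker(γ − 1 : Ωⁿ_K → Ωⁿ_K/Bⁿ_K)`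
  ([cite: GilleSzamuely2017, Thm. 9.2.4]; [cite: Kato1982, §1]).

Everything is proved; no named fact is introduced.

## References

* P. Gille, T. Szamuely, *Central simple algebras and Galois cohomology*, 2nd ed., CUP 2017, Lemma 9.2.1,
  Lemma 9.2.3, Thm. 9.2.4, §9.4. [GilleSzamuely2017]
* K. Kato, *Galois cohomology of complete discrete valuation fields*, LNM 967 (1982), §1. [Kato1982]
* L. Illusie, *Complexe de de Rham–Witt et cohomologie cristalline*, Ann. Sci. ÉNS 12 (1979), 0.(2.1). [Illusie1979]
-/

noncomputable section

open KaehlerDifferential (D)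
open ExteriorAlgebra (ι)
open Literature.AlgebraicGeometry.Crystalline (ιMul coe_ιMul ιMul_ιMulti)
open Literature.AlgebraicGeometry.Crystalline.KaehlerExteriorDerivative
  (kaehlerExteriorDerivative extD coe_kaehlerExteriorDerivative kaehlerExteriorDerivative_smul
    extD_ι_D extD_mul extD_algebraMap extD_ι_smul_D)

namespace Literature.NumberTheory.GaloisCohomology

universe u

section Ring

variable (p : ℕ) [hp : Fact p.Prime] (K : Type u) [CommRing K] [CharP K p]

/-! ### Closedness lemmas -/

omit hp in
/-- `c^p • θ` is closed when the one-form `θ` is (`D (c^p) = 0` in characteristic `p`). [folklore] -/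
theorem extD_ι_pow_char_smul (c : K) {θ : Ω[K⁄ℤ]} (hθ : extD ℤ K (ι K θ) = 0) :
    extD ℤ K (ι K (c ^ p • θ)) = 0 := by
  rw [map_smul, Algebra.smul_def, extD_mul, extD_algebraMap, D_pow_char, map_zero, zero_mul, zero_add, hθ,
    mul_zero]

omit hp [CharP K p] in
/-- A wedge `θ₁ ∧ ⋯ ∧ θₙ` of CLOSED one-forms is closed. [folklore] -/
theorem kaehlerExteriorDerivative_ιMulti_of_closed :
    ∀ {n : ℕ} (θ : Fin n → Ω[K⁄ℤ]), (∀ i, extD ℤ K (ι K (θ i)) = 0) →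
      kaehlerExteriorDerivative ℤ K n (exteriorPower.ιMulti K n θ) = 0
  | 0, θ, _ => Subtype.ext (by
      rw [coe_kaehlerExteriorDerivative, exteriorPower.ιMulti_apply_coe, ExteriorAlgebra.ιMulti_zero_apply,
        ← (algebraMap K (ExteriorAlgebra K (Ω[K⁄ℤ]))).map_one, extD_algebraMap, Derivation.map_one_eq_zero,
        map_zero, Submodule.coe_zero])
  | n + 1, θ, h => by
    rw [← Fin.cons_self_tail θ, ← ιMul_ιMulti]
    exact kaehlerExteriorDerivative_ιMul_of_closed n (h 0)
      (kaehlerExteriorDerivative_ιMulti_of_closed (Fin.tail θ) fun i => h i.succ)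

omit hp [CharP K p] in
/-- `ιMul n 0 = 0`. [folklore] -/
theorem ιMul_zero_left (n : ℕ) (ω : ⋀[K]^n (Ω[K⁄ℤ])) : ιMul n (0 : Ω[K⁄ℤ]) ω = 0 :=
  Subtype.ext (by rw [coe_ιMul, map_zero, zero_mul, Submodule.coe_zero])

/-! ### The derivation `b ↦ (b^{p-1} db) ∧ –` -/

/-- Transport of `wedgeH` along an equality of closed one-forms. [folklore] -/
theorem wedgeH_congr {θ θ' : Ω[K⁄ℤ]} (h : θ = θ') (hθ : extD ℤ K (ι K θ) = 0) (hθ' : extD ℤ K (ι K θ') = 0)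
    (n : ℕ) : wedgeH p θ hθ n = wedgeH p θ' hθ' n := by
  subst h
  rfl

/-- `wedgeH 0 = 0`. [folklore] -/
theorem wedgeH_zero (n : ℕ) : wedgeH p (0 : Ω[K⁄ℤ]) (by rw [map_zero, map_zero]) n = (0 : deRhamH p K n →ₗ[K] _) :=
  deRhamH.hom_ext p fun ω hω => by
    rw [wedgeH_cls, LinearMap.zero_apply, deRhamH.cls_congr (ιMul_zero_left K n ω) _ (map_zero _)]
    exact deRhamH.cls_eq_zero_of_mem_exactForms _ _ (AddSubgroup.zero_mem _)

/-- Additivity of the inverse Cartier operator on exact one-forms, at the level of `wedgeH`: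
`(a+b)^{p-1}d(a+b) ∧ – = a^{p-1}da ∧ – + b^{p-1}db ∧ –` on de Rham cohomology (the difference is
`dS_p(a,b) ∧ – = d(S_p(a,b) · –)`). [cite: GilleSzamuely2017, Lemma 9.2.1] -/
theorem wedgeH_cartierForm_add (a b : K) (n : ℕ) :
    wedgeH p (cartierForm p K (a + b)) (extD_ι_cartierForm p K (a + b)) n =
      wedgeH p (cartierForm p K a) (extD_ι_cartierForm p K a) n +
        wedgeH p (cartierForm p K b) (extD_ι_cartierForm p K b) n := by
  obtain ⟨s, hs⟩ := Derivation.exists_apply_eq_add_pow_sub p (D ℤ K) a b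
  have hs' : (D ℤ K s : Ω[K⁄ℤ]) =
      (a + b) ^ (p - 1) • D ℤ K (a + b) - a ^ (p - 1) • D ℤ K a - b ^ (p - 1) • D ℤ K b := hs
  have h : cartierForm p K (a + b) = (cartierForm p K a + cartierForm p K b) + D ℤ K s := by
    rw [hs', cartierForm, cartierForm, cartierForm]; abel
  have hab : extD ℤ K (ι K (cartierForm p K a + cartierForm p K b)) = 0 := by
    rw [map_add, map_add, extD_ι_cartierForm, extD_ι_cartierForm, add_zero]
  have habs : extD ℤ K (ι K ((cartierForm p K a + cartierForm p K b) + D ℤ K s)) = 0 := by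
    rw [map_add, map_add, hab, extD_ι_D, add_zero]
  calc wedgeH p (cartierForm p K (a + b)) (extD_ι_cartierForm p K (a + b)) n
      = wedgeH p ((cartierForm p K a + cartierForm p K b) + D ℤ K s) habs n := wedgeH_congr p K h _ _ n
    _ = wedgeH p (cartierForm p K a + cartierForm p K b) hab n + wedgeH p (D ℤ K s) (extD_ι_D ℤ K s) n :=
        wedgeH_add p _ _ hab (extD_ι_D ℤ K s) n
    _ = wedgeH p (cartierForm p K a + cartierForm p K b) hab n := by rw [wedgeH_D_eq_zero, add_zero]
    _ = wedgeH p (cartierForm p K a) (extD_ι_cartierForm p K a) n +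
          wedgeH p (cartierForm p K b) (extD_ι_cartierForm p K b) n :=
        wedgeH_add p _ _ (extD_ι_cartierForm p K a) (extD_ι_cartierForm p K b) n

/-- The Leibniz rule at the level of `wedgeH` (twisted scalars): `(ab)^{p-1}d(ab) ∧ – = a • (b^{p-1}db ∧ –) +
b • (a^{p-1}da ∧ –)`. [cite: GilleSzamuely2017, Lemma 9.2.1] -/
theorem wedgeH_cartierForm_mul (a b : K) (n : ℕ) :
    wedgeH p (cartierForm p K (a * b)) (extD_ι_cartierForm p K (a * b)) n =
      a • wedgeH p (cartierForm p K b) (extD_ι_cartierForm p K b) n +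
        b • wedgeH p (cartierForm p K a) (extD_ι_cartierForm p K a) n := by
  have ha := extD_ι_pow_char_smul p K a (extD_ι_cartierForm p K b)
  have hb := extD_ι_pow_char_smul p K b (extD_ι_cartierForm p K a)
  have hsum : extD ℤ K (ι K (a ^ p • cartierForm p K b + b ^ p • cartierForm p K a)) = 0 := by
    rw [map_add, map_add, ha, hb, add_zero]
  calc wedgeH p (cartierForm p K (a * b)) (extD_ι_cartierForm p K (a * b)) n
      = wedgeH p (a ^ p • cartierForm p K b + b ^ p • cartierForm p K a) hsum n :=
        wedgeH_congr p K (cartierForm_mul p K a b) _ _ n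
    _ = wedgeH p (a ^ p • cartierForm p K b) ha n + wedgeH p (b ^ p • cartierForm p K a) hb n :=
        wedgeH_add p _ _ ha hb n
    _ = a • wedgeH p (cartierForm p K b) (extD_ι_cartierForm p K b) n +
          b • wedgeH p (cartierForm p K a) (extD_ι_cartierForm p K a) n :=
        congrArg₂ (· + ·) (wedgeH_pow_smul p a _ (extD_ι_cartierForm p K b) n ha)
          (wedgeH_pow_smul p b _ (extD_ι_cartierForm p K a) n hb)

/-- **The Cartier derivation** `b ↦ (b^{p-1} db) ∧ –`: a `ℤ`-derivation of `K` with values in the `K`-module of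
`K`-linear maps `Hⁿ → Hⁿ⁺¹` of Frobenius-twisted de Rham cohomology. [cite: GilleSzamuely2017, Lemma 9.2.1] -/
def cartierDerivation (n : ℕ) : Derivation ℤ K (deRhamH p K n →ₗ[K] deRhamH p K (n + 1)) :=
  Derivation.mk'
    (AddMonoidHom.toIntLinearMap
      { toFun := fun b => wedgeH p (cartierForm p K b) (extD_ι_cartierForm p K b) n
        map_zero' := by
          rw [wedgeH_congr p K (cartierForm_zero p K) _ (by rw [map_zero, map_zero])]
          exact wedgeH_zero p K n
        map_add' := fun a b => wedgeH_cartierForm_add p K a b n })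
    (fun a b => wedgeH_cartierForm_mul p K a b n)

/-- `cartierDerivation n b = (b^{p-1} db) ∧ –`. [folklore] -/
@[simp] theorem cartierDerivation_apply (n : ℕ) (b : K) :
    cartierDerivation p K n b = wedgeH p (cartierForm p K b) (extD_ι_cartierForm p K b) n := rfl

/-- `θ_a ∧ θ_a ∧ – = 0` for the Cartier derivation. [folklore] -/
theorem cartierDerivation_comp_self (n : ℕ) (a : K) :
    (cartierDerivation p K (n + 1) a).comp (cartierDerivation p K n a) = 0 := by
  rw [cartierDerivation_apply, cartierDerivation_apply]
  exact wedgeH_comp_wedgeH_self p _ _ n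

/-- Anticommutation for the Cartier derivation. [folklore] -/
theorem cartierDerivation_comp_add (n : ℕ) (a b : K) :
    (cartierDerivation p K (n + 1) a).comp (cartierDerivation p K n b) +
      (cartierDerivation p K (n + 1) b).comp (cartierDerivation p K n a) = 0 := by
  simp only [cartierDerivation_apply]
  exact wedgeH_comp_wedgeH_add p _ _ _ _ n

/-- The base point `[1] ∈ H⁰` of the Cartier tower. [folklore] -/
def cartierBase : deRhamH p K 0 :=
  deRhamH.cls (exteriorPower.ιMulti K 0 fun i => i.elim0)
    (kaehlerExteriorDerivative_ιMulti_of_closed K _ fun i => i.elim0)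

/-! ### The operator -/

/-- **The inverse Cartier operator** `γ : Ωⁿ_K = ⋀ⁿ_K Ω[K⁄ℤ] → Hⁿ = Zⁿ/Bⁿ` in degree `n`, for a ring `K` of
prime characteristic `p`: the `K`-linear (= `p`-semilinear, the target being Frobenius-twisted) map with
`γ (db₁ ∧ ⋯ ∧ dbₙ) = [b₁^{p-1}db₁ ∧ ⋯ ∧ bₙ^{p-1}dbₙ]`, from the derivation tower of `cartierDerivation`.
[cite: GilleSzamuely2017, Lemma 9.2.1 and §9.4] -/
def invCartier (n : ℕ) : ⋀[K]^n (Ω[K⁄ℤ]) →ₗ[K] deRhamH p K n :=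
  DerivationTower.onForms K (deRhamH p K) (cartierDerivation p K) (cartierBase p K)
    (cartierDerivation_comp_self p K) (cartierDerivation_comp_add p K) n

/-- The tower value of the Cartier derivation is the class of `θ_{b₁} ∧ ⋯ ∧ θ_{bₙ}`. [folklore] -/
theorem towerVal_cartierDerivation : ∀ (n : ℕ) (v : Fin n → K),
    DerivationTower.towerVal K (deRhamH p K) (cartierDerivation p K) (cartierBase p K) n v =
      deRhamH.cls (exteriorPower.ιMulti K n fun i => cartierForm p K (v i))
        (kaehlerExteriorDerivative_ιMulti_of_closed K _ fun i => extD_ι_cartierForm p K (v i))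
  | 0, v => by
    rw [DerivationTower.towerVal, cartierBase]
    exact deRhamH.cls_congr (congrArg _ (funext fun i => i.elim0)) _ _
  | n + 1, v => by
    rw [DerivationTower.towerVal, towerVal_cartierDerivation n (Fin.tail v), cartierDerivation_apply, wedgeH_cls]
    refine deRhamH.cls_congr ?_ _ _
    rw [ιMul_ιMulti]
    exact congrArg _ (Fin.cons_self_tail fun i => cartierForm p K (v i))

/-- **`γ (db₁ ∧ ⋯ ∧ dbₙ) = [b₁^{p-1}db₁ ∧ ⋯ ∧ bₙ^{p-1}dbₙ]`.** [cite: GilleSzamuely2017, §9.4] -/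
theorem invCartier_ιMulti_D (n : ℕ) (v : Fin n → K) :
    invCartier p K n (exteriorPower.ιMulti K n fun i => D ℤ K (v i)) =
      deRhamH.cls (exteriorPower.ιMulti K n fun i => cartierForm p K (v i))
        (kaehlerExteriorDerivative_ιMulti_of_closed K _ fun i => extD_ι_cartierForm p K (v i)) := by
  rw [invCartier, DerivationTower.onForms_ιMulti_D, towerVal_cartierDerivation]

/-- The logarithmic form `dlog b₁ ∧ ⋯ ∧ dlog bₙ` is a closed `n`-form (each `dlog u = u⁻¹du` is closed:
`d(u⁻¹du) = -u⁻² du ∧ du = 0`), stated as membership in `closedTwist`. [folklore] -/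
theorem dlogForm_mem_closedTwist (n : ℕ) (b : Fin n → Kˣ) :
    FrobeniusTwist.of p K (dlogForm K b) ∈ closedTwist p K n :=
  kaehlerExteriorDerivative_ιMulti_of_closed K _ fun i => by
    rw [unitDlog, extD_ι_smul_D, (D ℤ K).leibniz_of_mul_eq_one (Units.inv_mul (b i)), map_smul, smul_mul_assoc,
      ExteriorAlgebra.ι_sq_zero, smul_zero]

omit [CharP K p] in
/-- For a unit `b`: `(b⁻¹)^p • b^{p-1} db = b⁻¹ db`, i.e. `(b⁻¹)^p • cartierForm b = dlog b`. [folklore] -/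
theorem inv_pow_smul_cartierForm (b : Kˣ) :
    (((b⁻¹ : Kˣ) : K) ^ p) • cartierForm p K b = unitDlog K b := by
  have h1 : p - 1 + 1 = p := Nat.sub_add_cancel hp.out.one_le
  have hy : ((b⁻¹ : Kˣ) : K) ^ p = ((b⁻¹ : Kˣ) : K) ^ (p - 1) * ((b⁻¹ : Kˣ) : K) := by rw [← pow_succ, h1]
  have hyx : ((b⁻¹ : Kˣ) : K) * (b : K) = 1 := by rw [← Units.val_mul, inv_mul_cancel, Units.val_one]
  rw [cartierForm, unitDlog, smul_smul, hy, mul_comm (((b⁻¹ : Kˣ) : K) ^ (p - 1)), mul_assoc, ← mul_pow, hyx,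
    one_pow, mul_one]

/-- `dlogForm b = (∏ bᵢ⁻¹) • (db₁ ∧ ⋯ ∧ dbₙ)`. [folklore] -/
theorem dlogForm_eq_prod_inv_smul_ιMulti_D (n : ℕ) (b : Fin n → Kˣ) :
    dlogForm K b = (∏ i, (((b i)⁻¹ : Kˣ) : K)) • exteriorPower.ιMulti K n fun i => D ℤ K (b i) := by
  rw [dlogForm, ← AlternatingMap.map_smul_univ]
  rfl

/-- **`γ (a • dlog b₁ ∧ ⋯ ∧ dlog bₙ) = [a^p • dlog b₁ ∧ ⋯ ∧ dlog bₙ]`** for units `bᵢ`: the defining formula of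
the inverse Cartier operator on logarithmic forms. [cite: GilleSzamuely2017, Lemma 9.2.1 and §9.4] -/
theorem invCartier_smul_dlogForm (n : ℕ) (a : K) (b : Fin n → Kˣ) :
    invCartier p K n (a • dlogForm K b) =
      deRhamH.cls (a ^ p • dlogForm K b)
        (by rw [kaehlerExteriorDerivative_pow_char_smul]
            exact smul_eq_zero_of_right _ (dlogForm_mem_closedTwist p K n b)) := by
  have h1 : invCartier p K n (dlogForm K b) = deRhamH.cls (dlogForm K b) (dlogForm_mem_closedTwist p K n b) := by
    conv_lhs => rw [dlogForm_eq_prod_inv_smul_ιMulti_D, map_smul, invCartier_ιMulti_D]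
    rw [deRhamH.smul_cls]
    refine deRhamH.cls_congr ?_ _ _
    rw [← Finset.prod_pow, ← AlternatingMap.map_smul_univ, dlogForm]
    exact congrArg _ (funext fun i => inv_pow_smul_cartierForm p K (b i))
  rw [map_smul, h1, deRhamH.smul_cls]

/-! ### To `Ωⁿ/Bⁿ`, and Kato's group as `coker(γ − 1)` -/

/-- The inclusion `Hⁿ = Zⁿ/Bⁿ → Ωⁿ/Bⁿ`, as an additive map (built through restriction of scalars to `ℤ`, the
target carrying no `K`-structure). [folklore] -/
def deRhamH.toQuot (n : ℕ) : deRhamH p K n →+ (⋀[K]^n (Ω[K⁄ℤ])) ⧸ exactForms K n :=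
  ((((exactTwist p K n).comap (closedTwist p K n).subtype).restrictScalars ℤ).liftQ
      (((QuotientAddGroup.mk' (exactForms K n)).comp
        ((FrobeniusTwist.of p K).symm.toAddMonoidHom.comp (closedTwist p K n).subtype.toAddMonoidHom)).toIntLinearMap)
      (by
        intro x hx
        rw [Submodule.restrictScalars_mem, Submodule.mem_comap] at hx
        rw [LinearMap.mem_ker, AddMonoidHom.coe_toIntLinearMap, AddMonoidHom.coe_comp, AddMonoidHom.coe_comp,
          Function.comp_apply, Function.comp_apply, QuotientAddGroup.mk'_apply, QuotientAddGroup.eq_zero_iff]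
        exact hx)).toAddMonoidHom.comp
    (Submodule.Quotient.restrictScalarsEquiv ℤ
      ((exactTwist p K n).comap (closedTwist p K n).subtype)).symm.toLinearMap.toAddMonoidHom

set_option maxHeartbeats 400000 in
/-- `toQuot [ω] = (ω mod Bⁿ)`. [folklore] -/
@[simp] theorem deRhamH.toQuot_cls {n : ℕ} (ω : ⋀[K]^n (Ω[K⁄ℤ])) (hω : kaehlerExteriorDerivative ℤ K n ω = 0) :
    deRhamH.toQuot p K n (deRhamH.cls ω hω) = ((ω : (⋀[K]^n (Ω[K⁄ℤ])) ⧸ exactForms K n)) :=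
  rfl

/-- **The inverse Cartier operator into `Ωⁿ_K/Bⁿ_K`**, as an additive map:
`γ (a • dlog b) = (a^p • dlog b mod Bⁿ)`. [cite: GilleSzamuely2017, Lemma 9.2.1 and §9.4] -/
def invCartierQuot (n : ℕ) : (⋀[K]^n (Ω[K⁄ℤ])) →+ (⋀[K]^n (Ω[K⁄ℤ])) ⧸ exactForms K n :=
  (deRhamH.toQuot p K n).comp (invCartier p K n).toAddMonoidHom

/-- `γ (a • dlog b) = (a^p • dlog b mod Bⁿ)`. [cite: GilleSzamuely2017, §9.4] -/
theorem invCartierQuot_smul_dlogForm (n : ℕ) (a : K) (b : Fin n → Kˣ) :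
    invCartierQuot p K n (a • dlogForm K b) =
      (((a ^ p • dlogForm K b : ⋀[K]^n (Ω[K⁄ℤ])) : (⋀[K]^n (Ω[K⁄ℤ])) ⧸ exactForms K n)) := by
  rw [invCartierQuot, AddMonoidHom.coe_comp, Function.comp_apply, LinearMap.toAddMonoidHom_coe,
    invCartier_smul_dlogForm, deRhamH.toQuot_cls]

end Ring

section Field

variable (p : ℕ) [hp : Fact p.Prime] (K : Type u) [Field K] [CharP K p]

/-- **Kato's `H^{n+1}_p(K)` through forms IS `coker(γ − 1)`** (Gille–Szamuely Thm. 9.2.4 / Kato 1982 §1 as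
printed): for a field `K` of characteristic `p` whose logarithmic forms span `Ωⁿ_K` over `K` (hypothesis
`hspan`; this holds for every field — `stub_formsSpan` of summit ResolutionOfSingularities — and is kept as a
hypothesis only to avoid restating that landed theorem), a form `ω` lies in
`exactForms K n ⊔ artinSchreierForms K p n` (the subgroup divided out in `KatoCohomologyDeRham p K n`) iff its
class modulo `Bⁿ_K` lies in the image of `γ − 1`, `γ = invCartierQuot p K n` the inverse Cartier operator.
[cite: GilleSzamuely2017, Thm. 9.2.4]; [cite: Kato1982, §1] -/
theorem mem_exactForms_sup_artinSchreierForms_iff (n : ℕ)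
    (hspan : Submodule.span K (Set.range (@dlogForm K _ n)) = ⊤) (ω : ⋀[K]^n (Ω[K⁄ℤ])) :
    ω ∈ exactForms K n ⊔ artinSchreierForms K p n ↔
      ∃ η : ⋀[K]^n (Ω[K⁄ℤ]), ((ω : (⋀[K]^n (Ω[K⁄ℤ])) ⧸ exactForms K n)) =
        invCartierQuot p K n η - ((η : ⋀[K]^n (Ω[K⁄ℤ])) : (⋀[K]^n (Ω[K⁄ℤ])) ⧸ exactForms K n) :=
  mem_exactForms_sup_artinSchreierForms_iff_of_inverseCartier p K n hspan (invCartierQuot p K n)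
    (invCartierQuot_smul_dlogForm p K n) ω

end Field

end Literature.NumberTheory.GaloisCohomology

end
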